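import Summits.Ventures.PercRepro.Night2TwoOneGeneralColumn
import Summits.Ventures.PercRepro.Night2TwoOneFloors
import Summits.Ventures.PercRepro.Night2TwoOneFloorsB

/-!
# PercRepro — the cell `(2, 1)` with exactly two fat closures, no spread hypothesis: THE CAPACITY FLOORS
(night-2, gen 28)

For a lossy basis pair `(B, z)` (profile `(3, 2)` along the plane, `profile_of_lossy_basis_pair`) every target `T`
with `(i, j) = (|T′ ∩ P|, |T′ ∖ P|)`, `n = |V|`, has `cap3 T ≥ vGen n i j` where `vGen` is `1` at `i + j ≥ n − 2`,
`143/180` at `i + j = n − 3` (load `≤ 37/180`), `11/18` at `j = 4` (both classes in `T`: no thin face, no load),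
`73/180` at `j = 3` (one class in `T`: no thin face, load `≤ 37/180`), `0` elsewhere (**`cap3_ge_vGen`**).
-/

namespace PercRepro.Shadow

open Finset PerFlat ThmH

variable {α : Type*} [DecidableEq α] {M : Matroid α} [M.Finite]

/-- The floors of the two-fat-closure cell without the spread hypothesis. -/
def vGen (n i j : ℕ) : ℚ :=
  if n ≤ i + j + 2 then 1
  else if i + j + 3 = n then 143 / 180
  else if j = 4 then 11 / 18
  else if j = 3 then 73 / 180
  else 0

/-- The floors are nonnegative. -/
theorem vGen_nonneg (n i j : ℕ) : 0 ≤ vGen n i j := by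
  unfold vGen
  split_ifs <;> norm_num

section GeneralFloors

variable {G : Finset α}

open scoped Classical in
/-- **THE CAPACITY FLOORS OF THE BASIS PAIRS' TARGETS, NO SPREAD HYPOTHESIS** (exactly two fat closures with
disjoint missed pairs, the completion rule along the off-plane points). -/
theorem cap3_ge_vGen (hG : G ∈ flatsQ M (5 + 1)) (hd : (gr M \ G).card = 2) (hk : kColoops M G = 1)
    (hs : ∀ e ∈ gr M, ∀ f ∈ gr M, e ≠ f → rkN M {e, f} = 2)
    {B₀ B₁ : Finset α} (hB₀ : B₀ ∈ thinMembers M 5 G) (hB₁ : B₁ ∈ thinMembers M 5 G)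
    (hm₀ : (G \ clF M B₀).card ≤ 2) (hm₁ : (G \ clF M B₁).card ≤ 2) (hne : clF M B₀ ≠ clF M B₁)
    (hfat : (fatClosures M 5 G 2).card ≤ 2) (hdisj : Disjoint (G \ clF M B₀) (G \ clF M B₁))
    {B : Finset α} (hB : B ∈ thinMembers M 5 G) (hB4 : (B \ coloops M G).card + 1 = 5) {z : α}
    (hz : z ∈ G \ clF M B) (hl0 : loss M 5 G B z ≠ 0) :
    ∀ T ∈ tgtSets M 5 G B z,
      vGen (G \ coloops M G).card
        (profileAt (coloops M G) ((clF M B₀ ∩ clF M B₁) \ coloops M G) T).1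
        (profileAt (coloops M G) ((clF M B₀ ∩ clF M B₁) \ coloops M G) T).2 ≤
      cap3 M 5 G (fun B => 5 ≤ (B \ coloops M G).card)
        (dshComp M 5 G ((G \ clF M B₀) ∪ (G \ clF M B₁))) T := by
  intro T hT
  have hd' : (gr M \ G).card ≤ 5 := by omega
  have hKH₀ : coloops M G ⊆ clF M B₀ := (coloops_subset_of_mem_thinMembers hG hd' hB₀).trans
    (subset_clF (mem_membersIn.1 (mem_thinMembers.1 hB₀).1).1)
  have hKH₁ : coloops M G ⊆ clF M B₁ := (coloops_subset_of_mem_thinMembers hG hd' hB₁).trans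
    (subset_clF (mem_membersIn.1 (mem_thinMembers.1 hB₁).1).1)
  have hA2 : (G \ clF M B₀).card = 2 := by
    have := two_le_card_sdiff_of_not_lay0 hG hd' (mem_thinMembers.1 hB₀).1 (mem_thinMembers.1 hB₀).2
    omega
  have hB2 : (G \ clF M B₁).card = 2 := by
    have := two_le_card_sdiff_of_not_lay0 hG hd' (mem_thinMembers.1 hB₁).1 (mem_thinMembers.1 hB₁).2
    omega
  obtain ⟨hTsh, hQT, -⟩ := mem_tgtSets.1 hT
  have hTG : T ⊆ G := subset_G_of_mem_shadowAt hTsh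
  have hKT : coloops M G ⊆ T := coloops_subset_of_mem_shadowAt hTsh
  have hdl := dload_comp_general_le_cap2 hG hd hk hs hB₀ hB₁ hm₀ hm₁ hne hfat hdisj
  have hdlT := dload_comp_general_le hG hd hk hs hB₀ hB₁ hm₀ hm₁ hne hfat hdisj T
  have hcap3 : 0 ≤ cap3 M 5 G (fun B => 5 ≤ (B \ coloops M G).card)
      (dshComp M 5 G ((G \ clF M B₀) ∪ (G \ clF M B₁))) T := cap3_nonneg (hdl T hTsh)
  have hdl0 : 0 ≤ dload M 5 G (fun B => 5 ≤ (B \ coloops M G).card)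
      (dshComp M 5 G ((G \ clF M B₀) ∪ (G \ clF M B₁))) T :=
    dload_nonneg (fun B z S => dshComp_nonneg hG hd' _ B z S) T
  obtain ⟨hXP3, -, hXr, ⟨u, huQ, hu⟩, ⟨u', hu'Q, hu'⟩⟩ :=
    profile_of_lossy_basis_pair hG hd hk hB₀ hB₁ hm₀ hm₁ hne hdisj hB hB4 hz hl0
  have huT : u ∈ T ∩ (G \ clF M B₀) := Finset.mem_inter.2 ⟨hQT huQ, hu⟩
  have hu'T : u' ∈ T ∩ (G \ clF M B₁) := Finset.mem_inter.2 ⟨hQT hu'Q, hu'⟩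
  set n := (G \ coloops M G).card with hn
  set P := (clF M B₀ ∩ clF M B₁) \ coloops M G with hPdef
  set Xs := (G \ clF M B₀) ∪ (G \ clF M B₁) with hXs
  obtain ⟨i, hi⟩ : ∃ i, i = (profileAt (coloops M G) P T).1 := ⟨_, rfl⟩
  obtain ⟨j, hj⟩ : ∃ j, j = (profileAt (coloops M G) P T).2 := ⟨_, rfl⟩
  rw [← hi, ← hj]
  simp only [profileAt] at hi hj
  have hTP : (T \ coloops M G) ∩ P = T ∩ P := sdiff_coloops_inter_plane
  have hTX : (T \ coloops M G) \ P = T ∩ Xs := sdiff_coloops_sdiff_plane hTG hKH₀ hKH₁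
  rw [hTP] at hi
  rw [hTX] at hj
  have hij : j + i = (T \ coloops M G).card := by
    rw [hi, hj, ← hTP, ← hTX]; exact Finset.card_sdiff_add_card_inter _ _
  have hGT : (G \ T).card + (T \ coloops M G).card = n := card_sdiff_add_eq_of_mem_shadowAt hTsh rfl
  have hTP3 : 3 ≤ rkN M (T ∩ P) := by
    refine le_trans hXr (rkN_mono ?_)
    exact Finset.inter_subset_inter (Finset.sdiff_subset.trans hQT) (Finset.Subset.refl _)
  have hXs4 : Xs.card = 4 := by
    rw [hXs, Finset.card_union_of_disjoint hdisj, hA2, hB2]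
  have hXsplit : (T ∩ Xs).card = ((G \ clF M B₀) ∩ T).card + ((G \ clF M B₁) ∩ T).card := by
    rw [hXs, Finset.inter_union_distrib_left, Finset.card_union_of_disjoint
      (hdisj.mono Finset.inter_subset_right Finset.inter_subset_right), Finset.inter_comm T, Finset.inter_comm T]
  have hcA : ((G \ clF M B₀) ∩ T).card ≤ 2 := (Finset.card_le_card Finset.inter_subset_left).trans hA2.le
  have hcB : ((G \ clF M B₁) ∩ T).card ≤ 2 := (Finset.card_le_card Finset.inter_subset_left).trans hB2.le
  -- a class with two points in `T` lies inside `T`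
  have hclA : ((G \ clF M B₀) ∩ T).card = 2 → G \ clF M B₀ ⊆ T := by
    intro h
    have : (G \ clF M B₀) ∩ T = G \ clF M B₀ :=
      Finset.eq_of_subset_of_card_le Finset.inter_subset_left (by omega)
    rw [← this]; exact Finset.inter_subset_right
  have hclB : ((G \ clF M B₁) ∩ T).card = 2 → G \ clF M B₁ ⊆ T := by
    intro h
    have : (G \ clF M B₁) ∩ T = G \ clF M B₁ :=
      Finset.eq_of_subset_of_card_le Finset.inter_subset_left (by omega)
    rw [← this]; exact Finset.inter_subset_right
  -- a whole class in `T` kills the layer-1 request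
  have hL1A : G \ clF M B₀ ⊆ T → L1 M 5 G T = 0 := fun hcl =>
    L1_eq_zero_of_class_subset' hG hd hk hB₀ hB₁ hm₀ hdisj hTG hKT hTP3 hu'T hcl
  have hL1B : G \ clF M B₁ ⊆ T → L1 M 5 G T = 0 := fun hcl =>
    L1_eq_zero_of_class_subset hG hd hk hB₀ hB₁ hm₁ hdisj hTG hKT hTP3 huT hcl
  unfold cap3
  unfold vGen
  by_cases h1 : n ≤ i + j + 2
  · rw [if_pos h1]
    have hc2 : cap2 M 5 G T = 1 := cap2_eq_one_of_card_le hG (by omega)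
    have hdl0' : dload M 5 G (fun B => 5 ≤ (B \ coloops M G).card) (dshComp M 5 G Xs) T = 0 := by
      by_contra hne0
      obtain ⟨y, hy, -, -, -, -, -, -, -, -, -, -, -, hGQ, -⟩ :=
        card_inter_eq_three_general hG hd hk hs hB₀ hB₁ hm₀ hm₁ hne hfat hdisj hne0
      have hyT : y ∈ T := (Finset.mem_inter.1 hy).2
      rw [sdiff_erase_eq_insert hyT (hTG hyT), Finset.card_insert_of_notMem (fun h => (Finset.mem_sdiff.1 h).2 hyT)]
        at hGQ
      omega
    rw [hc2, hdl0']
    norm_num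
  · rw [if_neg h1]
    by_cases h2 : i + j + 3 = n
    · rw [if_pos h2]
      have hc2 : cap2 M 5 G T = 1 := cap2_eq_one_of_card_le hG (by omega)
      rw [hc2]
      linarith
    · rw [if_neg h2]
      by_cases h3 : j = 4
      · rw [if_pos h3]
        have hcl : G \ clF M B₀ ⊆ T := hclA (by omega)
        have hL1 := hL1A hcl
        have hdl0' : dload M 5 G (fun B => 5 ≤ (B \ coloops M G).card) (dshComp M 5 G Xs) T = 0 := by
          by_contra hne0
          obtain ⟨-, -, -, -, -, -, -, -, -, -, -, -, -, -, hc⟩ :=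
            card_inter_eq_three_general hG hd hk hs hB₀ hB₁ hm₀ hm₁ hne hfat hdisj hne0
          rw [← hXs] at hc
          omega
        rw [hdl0', sub_zero]
        exact cap2_ge_of_L1_eq_zero hd hk hTG hL1
      · rw [if_neg h3]
        by_cases h5 : j = 3
        · rw [if_pos h5]
          have hL1 : L1 M 5 G T = 0 := by
            rcases Nat.lt_or_ge ((G \ clF M B₀) ∩ T).card 2 with hA | hA
            · exact hL1B (hclB (by omega))
            · exact hL1A (hclA (by omega))
          have hc2 := cap2_ge_of_L1_eq_zero hd hk hTG hL1
          linarith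
        · rw [if_neg h5]
          exact hcap3

end GeneralFloors

end PercRepro.Shadow
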